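import Literature.Analysis.Complex.DeBruijnStripShift
import Literature.Analysis.Fourier.FourierUniquenessL1
import HarnessLib

/-!
# de Bruijn's Theorem 13 (universal factor `e^{λ²t²/2}`, general `Δ`): discharge of the named fact

Trunk T-ANALYSIS support (`Literature/Analysis/Complex`). This file discharges the named fact
`Literature.Analysis.Complex.DeBruijn1950.thm13` (`DeBruijnUniversalFactors.lean`;
N. G. de Bruijn, *The roots of trigonometric integrals*, Duke Math. J. **17** (1950), 197–226,
Thm. 13, p. 205): for an admissible kernel `F` (integrable, `F(−t) = F(t)^*`,
`F = O(e^{−|t|^b})` with `b > 2`), if the roots of `f(z) = ∫ F(t) e^{izt} dt` lie in the strip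
`|Im z| ≤ Δ` then those of `g(z) = ∫ F(t) e^{λ²t²/2} e^{izt} dt` lie in `|Im z| ≤ √max(Δ² − λ², 0)`.

Everything but one point is `Literature.Analysis.Complex.DeBruijn1950.rootsInStrip_gaussian`
(`DeBruijnStripShift.lean`: de Bruijn's proof — `N²` shifts of step `λ/N`, `cosh(λt/N)^{N²} → e^{λ²t²/2}`,
Hurwitz — with his Thm. 8 proved Hadamard-free), which carries the extra hypothesis `g ≢ 0`
needed by Hurwitz's theorem. Here we remove it: `RootsInStrip f Δ` forces `f ≢ 0`, hence
`F ≠ 0` in `L¹`, hence `F e^{λ²t²/2} ≠ 0` in `L¹`, hence `g ≢ 0` by the **uniqueness theorem for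
the Fourier transform on `L¹`** (`Literature.Analysis.Fourier.ae_eq_zero_of_forall_fourier_eq_zero`), since
`g(−2πw) = 𝓕(F e^{λ²t²/2})(w)` for real `w`. (In de Bruijn's statement, which is about the
location of the roots of `g`, the non-vanishing `g ≢ 0` is implicit; it is supplied here.)

## Contents (all proved)

* `Literature.Analysis.Complex.trigIntegral_ofReal_eq_fourier` — `trigIntegral G (−2πw) = 𝓕 G w` for real `w`.
* `Literature.Analysis.Complex.exists_trigIntegral_ne_zero` — an integrable kernel that is not a.e. zero
  has a trigonometric integral that is not identically zero (Fourier uniqueness).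
* `Literature.Analysis.Complex.ae_eq_zero_of_trigIntegral_eq_zero` — conversely phrased: `∫ G e^{izt} ≡ 0 ⇒ G = 0` a.e.
* `Literature.Analysis.Complex.DeBruijn1950.exists_trigIntegral_gaussian_ne_zero` — for admissible `F` with
  `RootsInStrip (trigIntegral F) Δ`, the function `∫ F(t) e^{λ²t²/2} e^{izt} dt` is `≢ 0`.
* `Literature.Analysis.Complex.DeBruijn1950.thm13_holds : thm13` — **the discharge**.

## References

* N. G. de Bruijn, *The roots of trigonometric integrals*, Duke Math. J. 17 (1950), 197–226, Thm. 13.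
* Y. Katznelson, *An introduction to harmonic analysis*, 3rd ed., 2004, Ch. VI §1.11 (uniqueness
  theorem for `L¹(ℝ)`).
-/

noncomputable section

open MeasureTheory Filter
open _root_.Complex hiding exp
open scoped FourierTransform

namespace Literature.Analysis.Complex

/-! ## Trigonometric integrals at real points are Fourier transforms -/

/-- For real `w`, `trigIntegral G (−2πw) = ∫ G(t) e^{−2πiwt} dt = 𝓕 G (w)` (Mathlib's
normalisation of the Fourier transform). [folklore] -/
theorem trigIntegral_ofReal_eq_fourier (G : ℝ → ℂ) (w : ℝ) :
    trigIntegral G ((-(2 * Real.pi * w) : ℝ) : ℂ) = 𝓕 G w := by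
  rw [Real.fourier_real_eq_integral_exp_smul, trigIntegral]
  refine integral_congr_ae (Eventually.of_forall fun t ↦ ?_)
  simp only [smul_eq_mul]
  rw [mul_comm (G t)]
  congr 1
  congr 1
  push_cast
  ring

/-- **A trigonometric integral of a kernel that is not a.e. zero is not identically zero**
(uniqueness theorem for the Fourier transform on `L¹`): if `G` is integrable and
`∫ G(t) e^{ixt} dt = 0` for all real `x`, then `G = 0` a.e. [cite: Katznelson2004, Ch. VI §1.11 Corollary] -/
theorem ae_eq_zero_of_trigIntegral_eq_zero {G : ℝ → ℂ} (hG : Integrable G)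
    (h : ∀ x : ℝ, trigIntegral G x = 0) : G =ᵐ[volume] 0 :=
  Literature.Analysis.Fourier.ae_eq_zero_of_forall_fourier_eq_zero hG fun w ↦ by
    rw [← trigIntegral_ofReal_eq_fourier]
    exact h _

/-- If `G` is integrable and not a.e. zero, then `trigIntegral G x ≠ 0` for some real `x`.
[cite: Katznelson2004, Ch. VI §1.11 Corollary] -/
theorem exists_trigIntegral_ne_zero {G : ℝ → ℂ} (hG : Integrable G) (hG0 : ¬ G =ᵐ[volume] 0) :
    ∃ x : ℝ, trigIntegral G x ≠ 0 := by
  by_contra hcon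
  push Not at hcon
  exact hG0 (ae_eq_zero_of_trigIntegral_eq_zero hG hcon)

/-- A kernel that is a.e. zero has identically vanishing trigonometric integral. [folklore] -/
theorem trigIntegral_eq_zero_of_ae_eq_zero {G : ℝ → ℂ} (hG : G =ᵐ[volume] 0) (z : ℂ) :
    trigIntegral G z = 0 := by
  rw [trigIntegral, ← integral_zero]
  refine integral_congr_ae ?_
  filter_upwards [hG] with t ht
  simp [ht]

namespace DeBruijn1950

variable {F : ℝ → ℂ}

/-- The Gaussian-weighted kernel `F(t) e^{λ²t²/2}` of an admissible `F` is integrable.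
[cite: Bruijn1950, Thm. 13] -/
theorem IsAdmissible.integrable_mul_gaussian (hF : IsAdmissible F) (lam : ℝ) :
    Integrable fun t : ℝ ↦ F t * (Real.exp (lam ^ 2 * t ^ 2 / 2) : ℝ) := by
  refine (hF.integrable_norm_mul_gaussian (lam ^ 2 / 2) 0).mono'
    (hF.integrable.aestronglyMeasurable.mul (by fun_prop)) (Eventually.of_forall fun t ↦ ?_)
  rw [norm_mul, Complex.norm_real, Real.norm_eq_abs, abs_of_pos (Real.exp_pos _), zero_mul,
    Real.exp_zero, mul_one]
  exact le_of_eq (by congr 2; ring)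

/-- **The target function of Thm. 13 is not identically zero.** If `F` is admissible and the
roots of `f = ∫ F(t) e^{izt} dt` lie in some strip (so that `f ≢ 0`), then
`g(z) = ∫ F(t) e^{λ²t²/2} e^{izt} dt` is not identically zero: otherwise `F e^{λ²t²/2} = 0` a.e.
by Fourier uniqueness, so `F = 0` a.e. and `f ≡ 0`. [cite: Bruijn1950, Thm. 13] -/
theorem exists_trigIntegral_gaussian_ne_zero (hF : IsAdmissible F) {Δ : ℝ}
    (hroots : RootsInStrip (trigIntegral F) Δ) (lam : ℝ) :
    ∃ z : ℂ, trigIntegral (fun t ↦ F t * (Real.exp (lam ^ 2 * t ^ 2 / 2) : ℝ)) z ≠ 0 := by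
  have hG0 : ¬ (fun t ↦ F t * (Real.exp (lam ^ 2 * t ^ 2 / 2) : ℝ)) =ᵐ[volume] 0 := by
    intro hG
    obtain ⟨z, hz⟩ := hroots.exists_ne_zero
    refine hz (trigIntegral_eq_zero_of_ae_eq_zero ?_ z)
    filter_upwards [hG] with t ht
    have hexp : ((Real.exp (lam ^ 2 * t ^ 2 / 2) : ℝ) : ℂ) ≠ 0 :=
      Complex.ofReal_ne_zero.2 (Real.exp_pos _).ne'
    simpa [hexp] using ht
  obtain ⟨x, hx⟩ := exists_trigIntegral_ne_zero (hF.integrable_mul_gaussian lam) hG0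
  exact ⟨x, hx⟩

/-- **Discharge of the named fact `DeBruijn1950.thm13` (de Bruijn 1950, Thm. 13, p. 205).**
Let `F` be integrable with `F(−t) = F(t)^*` and `F(t) = O(e^{−|t|^b})` for some `b > 2`, and
suppose the roots of `f(z) = ∫ F(t) e^{izt} dt` lie in the strip `|Im z| ≤ Δ` (`Δ ≥ 0`). Then
the roots of `∫ F(t) e^{λ²t²/2} e^{izt} dt` lie in the strip `|Im z| ≤ √max(Δ² − λ², 0)`.
(`rootsInStrip_gaussian` + `exists_trigIntegral_gaussian_ne_zero`.) [cite: Bruijn1950, Thm. 13] -/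
theorem thm13_holds : thm13 := fun _F _Δ lam hΔ hF hroots ↦
  rootsInStrip_gaussian hF hΔ lam hroots (exists_trigIntegral_gaussian_ne_zero hF hroots lam)

end DeBruijn1950

end Literature.Analysis.Complex
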